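import Summits.HodgeConjecture.HodgeConjecture.Theorems.Ring2AtlasCMSixfolds
import Literature.AlgebraicGeometry.ComplexMultiplication.PrimitiveCMTypeSimple
import Literature.NumberTheory.ComplexMultiplication.CMTypeDictionary
import Literature.AlgebraicGeometry.Motives.ZarhinHodgeGroupAutC
import Mathlib.NumberTheory.Cyclotomic.PrimitiveRoots
import Mathlib.NumberTheory.Cyclotomic.Gal
import Mathlib.NumberTheory.NumberField.CMField
import Mathlib.NumberTheory.NumberField.Cyclotomic.Basic
import Mathlib.NumberTheory.NumberField.InfinitePlace.Embeddings
import Mathlib.RingTheory.RootsOfUnity.Complex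
import Mathlib.RingTheory.Polynomial.Cyclotomic.Roots
import Mathlib.FieldTheory.Minpoly.Field
import Mathlib.Algebra.Algebra.Hom.Rat
import Mathlib.FieldTheory.Galois.Basic
import Mathlib.FieldTheory.Galois.Abelian
import Mathlib.Data.ZMod.QuotientGroup
import HarnessLib

set_option linter.dupNamespace false

/-!
# Ring 2 · atlas-2 — carriers of the `Y₃ × Y₃'` non-vacuity witness: the cyclic CM field of degree 6 in `ℚ(ζ₂₁)`

HONEST FRAMING: research route conditional on HC_CM; not a corollary; Q11.4-sentence-2 already refuted in dim ≥ 3.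

Cell `pub-hodge-ring2`, seat `pub-hodge-ring2-atlas-2` (generation 53). First third (split for the 400-line
lint) of the non-vacuity proof for the OPEN `g = 6` cell `HodgeUnitaryThreefoldPair` (`Ring2AtlasSixfolds` §3:
`Y × Y'` for two NON-ISOGENOUS simple abelian THREEFOLDS `Y, Y'` with multiplication by the same imaginary
quadratic field `k = ℚ(√-d)`); the other two parts are `Ring2AtlasCMThreefoldsCyclotomic9` (the factor `Y`: a
primitive CM type of `ℚ(ζ₉)`) and `Ring2AtlasUnitaryThreefoldPairNonVacuity` (the factor `Y'`, non-isogeny, the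
cell theorems). The witness takes `d = 3`: BOTH CM fields must be sextic CM fields containing `ζ₃`, and they must
be DIFFERENT fields (all primitive CM types of one cyclic sextic CM field form a single Galois orbit, so their
realisations are pairwise isogenous). The field of `Y'` built here is the cyclic subfield `K` of degree `6` of
`ℚ(ζ₂₁)` fixed by `ζ ↦ ζ¹³` (`13² = 169 ≡ 1 mod 21`; `13 ≡ 1 mod 3`, `13 ≡ -1 mod 7`, so `K = ℚ(ζ₃)·ℚ(ζ₇)⁺`);
it contains `ζ₃ = ζ₂₁⁷` (`7 · 13 ≡ 7 mod 21`) and is NOT the maximal real subfield (fixed by `ζ ↦ ζ²⁰`).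
Shimura 1998 §8.4, after Example (1) [held text, chunk p0085, verbatim]: «We can similarly treat the case
where `F` is cyclic over `Q`.» (`Gal(K/ℚ) = (ℤ/21)^×/{1, 13} ≅ ℤ/6`.)

Contents (namespace `Cyclotomic21`, alongside generation 46's lemmas on the full field `ℚ(ζ₂₁)`, no name
reused; Mathlib carriers; every statement proved outright, no hypothesis; the layout is that of
`Ring2AtlasCMFivefoldsCyclotomic33` (generation 52) with `33 ↦ 21`, `10 ↦ 13`):
* `L21 := CyclotomicField 21 ℚ`: `[L21 : ℚ] = φ(21) = 12` (`finrank_L21`), Galois over `ℚ`; `ζ := zeta 21`,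
  `μ := e^{2πi/21} ∈ ℂ`, `conj μ = μ²⁰`; complex embeddings of `ℚ(ζ₂₁)` ↔ exponents prime to `21`
  (`exists_apply_ζ_eq`, `exists_embedding_apply_ζ_eq`, `ringHom_ext_ζ`); `Aut(ℂ)` is transitive on them
  (`exists_ringEquiv_comp_eq`, from `Motives.ZarhinLie.exists_ringEquiv_complex_comp_eq`).
* `σ : ζ ↦ ζ¹³` (`IsCyclotomicExtension.fromZetaAut`), `σ² = 1 ≠ σ`; `H := ⟨σ⟩`, `|H| = 2`
  (`exists_apply_ζ_of_mem_H`: elements of `H` send `ζ ↦ ζ^(13^j)`, `j < 2`).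
* `K6 := ℚ(ζ₂₁)^H`: `[ℚ(ζ₂₁) : K] = 2`, `[K : ℚ] = 6` (`finrank_K6`), `Gal(ℚ(ζ₂₁)/K) = H` (`fixingSubgroup_K6`),
  `x ∈ K ⟺ σ x = x` (`mem_K6_iff`); every complex embedding of `K` extends to `ℚ(ζ₂₁)` (`exists_extension`),
  two extensions differ by an element of `H` (`exists_exponent_of_comp_eq`); `K` is totally complex (complex
  conjugation `ζ ↦ ζ²⁰` is not in `H`: `core_negOne_notMem_H`, `decide`), abelian over `ℚ`, hence a CM FIELD
  (`instIsCMFieldK6`, Mathlib's `NumberField.IsCMField.of_isAbelianGalois`).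
* `ω := ζ⁷ ∈ K` (`zeta3K`, `isPrimitiveRoot_zeta3K`): a primitive cube root of unity INSIDE `K`, so
  `√-3 = 2ω + 1 ∈ K` — the source of the endomorphism `ψ'` with `ψ' ≫ ψ' = -3`.
* THE NON-ISOGENY INPUT `not_isPrimitiveRoot_nine`: `ℚ(ζ₂₁)` contains NO primitive 9th root of unity `u`
  (else `u · ζ³` would be a primitive 63rd root of unity, of degree `φ(63) = 36 > 12 = [ℚ(ζ₂₁) : ℚ]`); hence
  no ring homomorphism `ℚ(ζ₉) → ℚ(ζ₂₁)` (`not_nonempty_ringHom_cyclotomicNine`): `End⁰(Y) ≅ ℚ(ζ₉)` does not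
  embed in `End⁰(Y') ≅ K ⊂ ℚ(ζ₂₁)` (companion module).

WHAT THIS IS NOT: number-field bookkeeping only — no atlas word, cell `def`, KIND or count is touched and
nothing here mentions abelian varieties or Hodge classes.

References: [Shimura1998] G. Shimura, *Abelian Varieties with Complex Multiplication and Modular Functions*,
Princeton (1998), §8.4 (p. 64); §5.5 (CM fields).
-/

noncomputable section

open Polynomial NumberField

namespace Summit.HodgeConjecture.HodgeConjecture.Ring2.Atlas

open Literature.AlgebraicGeometry Literature.AlgebraicGeometry.Motives
open Literature.AlgebraicGeometry.ComplexMultiplication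
open Literature.NumberTheory.ComplexMultiplication

namespace Cyclotomic21

/-- The twenty-first cyclotomic field `ℚ(ζ₂₁)` (Mathlib's `CyclotomicField 21 ℚ`); Shimura's Galois
closure `L`. [folklore] -/
abbrev L21 : Type := CyclotomicField 21 ℚ

/-- `ℚ(ζ₂₁)/ℚ` is the 21st cyclotomic extension (re-registered on the `DivisionRing.toRatAlgebra` path,
as for `Cyclotomic33.L33`). [folklore] -/
instance instIsCyclotomicExtensionL21 : IsCyclotomicExtension {21} ℚ L21 :=
  CyclotomicField.isCyclotomicExtension 21 ℚ

/-- The 21st cyclotomic polynomial is irreducible over `ℚ`. [folklore] -/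
theorem irreducible_cyclotomic21 : Irreducible (cyclotomic 21 ℚ) :=
  cyclotomic.irreducible_rat (by norm_num)

/-- `ℚ(ζ₂₁)/ℚ` is Galois. [folklore] -/
instance instIsGaloisL21 : IsGalois ℚ L21 := IsCyclotomicExtension.isGalois {21} ℚ L21

/-- `φ(21) = φ(3) φ(7) = 12`. [folklore] -/
theorem totient_21 : Nat.totient 21 = 12 := by
  rw [show (21 : ℕ) = 3 * 7 by norm_num, Nat.totient_mul (by norm_num : Nat.Coprime 3 7),
    Nat.totient_prime Nat.prime_three, Nat.totient_prime (by norm_num : Nat.Prime 7)]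

/-- `[ℚ(ζ₂₁) : ℚ] = φ(21) = 12`. [folklore] -/
theorem finrank_L21 : Module.finrank ℚ L21 = 12 := by
  rw [IsCyclotomicExtension.finrank (n := 21) L21 irreducible_cyclotomic21]
  exact totient_21

/-- The distinguished primitive 21st root of unity `ζ ∈ ℚ(ζ₂₁)`. [folklore] -/
def ζ : L21 := IsCyclotomicExtension.zeta 21 ℚ L21

/-- `ζ` is a primitive 21st root of unity. [folklore] -/
theorem isPrimitiveRoot_ζ : IsPrimitiveRoot ζ 21 := IsCyclotomicExtension.zeta_spec 21 ℚ L21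

/-- `ζ²¹ = 1`. [folklore] -/
theorem ζ_pow_21 : ζ ^ 21 = 1 := isPrimitiveRoot_ζ.pow_eq_one

/-- Exponents of `ζ` only matter mod `21`. [folklore] -/
theorem ζ_pow_mod (n : ℕ) : ζ ^ n = ζ ^ (n % 21) := by
  conv_lhs => rw [← Nat.div_add_mod n 21]
  rw [pow_add, pow_mul, ζ_pow_21, one_pow, one_mul]

/-- `μ = e^{2πi/21} ∈ ℂ`. [folklore] -/
def μ : ℂ := Complex.exp (2 * Real.pi * Complex.I / (21 : ℕ))

/-- `μ` is a primitive 21st root of unity in `ℂ`. [folklore] -/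
theorem isPrimitiveRoot_μ : IsPrimitiveRoot μ 21 := Complex.isPrimitiveRoot_exp 21 (by norm_num)

/-- `μ²¹ = 1`. [folklore] -/
theorem μ_pow_21 : μ ^ 21 = 1 := isPrimitiveRoot_μ.pow_eq_one

/-- Exponents of `μ` only matter mod `21`. [folklore] -/
theorem μ_pow_mod (n : ℕ) : μ ^ n = μ ^ (n % 21) := by
  conv_lhs => rw [← Nat.div_add_mod n 21]
  rw [pow_add, pow_mul, μ_pow_21, one_pow, one_mul]

/-- `μ^i = μ^j` with `i, j < 21` forces `i = j`. [folklore] -/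
theorem μ_pow_inj {i j : ℕ} (hi : i < 21) (hj : j < 21) (h : μ ^ i = μ ^ j) : i = j :=
  isPrimitiveRoot_μ.pow_inj hi hj h

/-- Complex conjugation inverts `μ`: `conj μ = μ²⁰`. [folklore] -/
theorem conj_μ : starRingEnd ℂ μ = μ ^ 20 := by
  have h1 : ‖μ‖ = 1 := Complex.norm_eq_one_of_pow_eq_one μ_pow_21 (by norm_num)
  rw [← Complex.inv_eq_conj h1]
  have h2 : μ ^ 20 * μ = 1 := by rw [← pow_succ, μ_pow_21]
  exact inv_eq_of_mul_eq_one_left h2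

/-- Every complex embedding of `ℚ(ζ₂₁)` sends `ζ` to `μ^a` for a unique `a < 21` prime to `21`. [folklore] -/
theorem exists_apply_ζ_eq (s : L21 →+* ℂ) : ∃ a : ℕ, a < 21 ∧ a.Coprime 21 ∧ s ζ = μ ^ a := by
  have hprim : IsPrimitiveRoot (s ζ) 21 := isPrimitiveRoot_ζ.map_of_injective s.injective
  obtain ⟨i, hi, hiζ⟩ := isPrimitiveRoot_μ.eq_pow_of_pow_eq_one hprim.pow_eq_one
  refine ⟨i, hi, ?_, hiζ.symm⟩
  rw [← hiζ] at hprim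
  exact (isPrimitiveRoot_μ.pow_iff_coprime (by norm_num) i).1 hprim

/-- For every `c` prime to `21` there is a complex embedding `ζ ↦ μ^c`. [folklore] -/
theorem exists_embedding_apply_ζ_eq {c : ℕ} (hc : c.Coprime 21) : ∃ s : L21 →+* ℂ, s ζ = μ ^ c := by
  have hmem : μ ^ c ∈ primitiveRoots 21 ℂ :=
    (mem_primitiveRoots (by norm_num)).2 (isPrimitiveRoot_μ.pow_of_coprime c hc)
  refine ⟨((isPrimitiveRoot_ζ.embeddingsEquivPrimitiveRoots ℂ irreducible_cyclotomic21).symm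
    ⟨μ ^ c, hmem⟩).toRingHom, ?_⟩
  have h := isPrimitiveRoot_ζ.embeddingsEquivPrimitiveRoots_apply_coe ℂ irreducible_cyclotomic21
    ((isPrimitiveRoot_ζ.embeddingsEquivPrimitiveRoots ℂ irreducible_cyclotomic21).symm ⟨μ ^ c, hmem⟩)
  rw [Equiv.apply_symm_apply] at h
  exact h.symm

/-- A complex embedding of `ℚ(ζ₂₁)` is determined by the image of `ζ`. [folklore] -/
theorem ringHom_ext_ζ {s t : L21 →+* ℂ} (h : s ζ = t ζ) : s = t := by
  have key : s.toRatAlgHom = t.toRatAlgHom :=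
    (isPrimitiveRoot_ζ.powerBasis ℚ).algHom_ext (by
      simpa [IsPrimitiveRoot.powerBasis_gen, RingHom.toRatAlgHom_apply] using h)
  calc s = (s.toRatAlgHom : L21 →+* ℂ) := (RingHom.toRatAlgHom_toRingHom s).symm
    _ = (t.toRatAlgHom : L21 →+* ℂ) := by rw [key]
    _ = t := RingHom.toRatAlgHom_toRingHom t

/-- A `ℚ`-automorphism of `ℚ(ζ₂₁)` is determined by the image of `ζ`. [folklore] -/
theorem algEquiv_ext_ζ {f g : L21 ≃ₐ[ℚ] L21} (h : f ζ = g ζ) : f = g := by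
  apply AlgEquiv.coe_toAlgHom_injective
  exact (isPrimitiveRoot_ζ.powerBasis ℚ).algHom_ext (by
    simpa [IsPrimitiveRoot.powerBasis_gen] using h)

/-- `Aut(ℂ)` is transitive on the complex embeddings of `ℚ(ζ₂₁)`. [folklore] -/
theorem exists_ringEquiv_comp_eq (s s' : L21 →+* ℂ) : ∃ τ : ℂ ≃+* ℂ, ∀ x, τ (s x) = s' x := by
  haveI : Countable L21 := Countable.of_equiv _ (Module.finBasis ℚ L21).equivFun.toEquiv.symm
  exact Motives.ZarhinLie.exists_ringEquiv_complex_comp_eq s s'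

/-! ### The involution `σ : ζ ↦ ζ¹³` and the subgroup `H = ⟨σ⟩` of order `2` -/

/-- `ζ¹³` is again a primitive 21st root of unity. [folklore] -/
theorem isPrimitiveRoot_ζ13 : IsPrimitiveRoot (ζ ^ 13) 21 :=
  isPrimitiveRoot_ζ.pow_of_coprime 13 (by decide)

/-- The automorphism `σ` of `ℚ(ζ₂₁)` with `σ ζ = ζ¹³` (`13` has order `2` in `(ℤ/21)^×`). [folklore] -/
def σ : L21 ≃ₐ[ℚ] L21 := IsCyclotomicExtension.fromZetaAut isPrimitiveRoot_ζ13 irreducible_cyclotomic21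

/-- `σ ζ = ζ¹³`. [folklore] -/
theorem σ_ζ : σ ζ = ζ ^ 13 := IsCyclotomicExtension.fromZetaAut_spec isPrimitiveRoot_ζ13 irreducible_cyclotomic21

/-- `σⁿ ζ = ζ^(13ⁿ)`. [folklore] -/
theorem σ_pow_ζ (n : ℕ) : (σ ^ n) ζ = ζ ^ (13 ^ n) := by
  induction n with
  | zero => simp
  | succ n ih => rw [pow_succ, AlgEquiv.mul_apply, σ_ζ, map_pow, ih, ← pow_mul, ← pow_succ]

/-- `σ² = 1` (`13² = 169 ≡ 1 mod 21`). [folklore] -/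
theorem σ_pow_two : σ ^ 2 = 1 := by
  apply algEquiv_ext_ζ
  rw [σ_pow_ζ, AlgEquiv.one_apply, ζ_pow_mod]
  norm_num

/-- `σ ≠ 1`. [folklore] -/
theorem σ_ne_one : σ ≠ 1 := by
  intro h
  have h13 : ζ ^ 13 = ζ ^ 1 := by rw [pow_one, ← σ_ζ, h, AlgEquiv.one_apply]
  have := isPrimitiveRoot_ζ.pow_inj (by norm_num) (by norm_num) h13
  omega

/-- `H = ⟨σ⟩ ≤ Gal(ℚ(ζ₂₁)/ℚ)`, the subgroup `{ζ ↦ ζ, ζ ↦ ζ¹³}` of order `2` (Shimura's `H₁`). [folklore] -/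
def H : Subgroup (L21 ≃ₐ[ℚ] L21) := Subgroup.zpowers σ

/-- `|H| = 2`. [folklore] -/
theorem card_H : Nat.card H = 2 := by
  haveI : Fact (Nat.Prime 2) := ⟨Nat.prime_two⟩
  rw [H, Nat.card_zpowers, orderOf_eq_prime σ_pow_two σ_ne_one]

/-- Elements of `H` send `ζ` to `ζ^(13^j)`, `j < 2`. [folklore] -/
theorem exists_apply_ζ_of_mem_H {g : L21 ≃ₐ[ℚ] L21} (hg : g ∈ H) : ∃ j : ℕ, j < 2 ∧ g ζ = ζ ^ (13 ^ j) := by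
  obtain ⟨k, rfl⟩ := Subgroup.mem_zpowers_iff.mp hg
  have hk : σ ^ k = σ ^ ((k % 2).toNat) := by
    haveI : Fact (Nat.Prime 2) := ⟨Nat.prime_two⟩
    have h1 := zpow_mod_orderOf σ k
    rw [orderOf_eq_prime σ_pow_two σ_ne_one] at h1
    rw [← h1, ← zpow_natCast, Int.toNat_of_nonneg (Int.emod_nonneg k (by norm_num))]
    norm_cast
  refine ⟨(k % 2).toNat, ?_, ?_⟩
  · have : k % 2 < 2 := Int.emod_lt_of_pos k (by norm_num)
    omega
  · rw [hk, σ_pow_ζ]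

/-! ### The field `K = ℚ(ζ₂₁)^H`, cyclic of degree `6` over `ℚ` -/

/-- **The CM field of the factor `Y'`**: `K := ℚ(ζ₂₁)^⟨σ⟩`, the fixed field of `H = {ζ ↦ ζ, ζ ↦ ζ¹³}`, a
subfield of degree `6` of `ℚ(ζ₂₁)` (cyclic over `ℚ`; `= ℚ(ζ₃)·ℚ(ζ₇ + ζ₇⁻¹)`) containing `ζ₃ = ζ⁷`. [folklore] -/
def K6 : IntermediateField ℚ L21 := IntermediateField.fixedField H

/-- `[ℚ(ζ₂₁) : K] = |H| = 2`. [folklore] -/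
theorem finrank_K6_L21 : Module.finrank K6 L21 = 2 := by
  rw [K6, IntermediateField.finrank_fixedField_eq_card, card_H]

/-- `[K : ℚ] = 12 / 2 = 6`. [folklore] -/
theorem finrank_K6 : Module.finrank ℚ K6 = 6 := by
  have h := Module.finrank_mul_finrank ℚ K6 L21
  rw [finrank_K6_L21, finrank_L21] at h
  omega

/-- `K` is a number field. [folklore] -/
instance instNumberFieldK6 : NumberField K6 := inferInstance

/-- The automorphisms of `ℚ(ζ₂₁)` fixing `K` pointwise are exactly `H` (Galois correspondence).
[folklore] -/
theorem fixingSubgroup_K6 : IntermediateField.fixingSubgroup K6 = H :=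
  IntermediateField.fixingSubgroup_fixedField H

/-- `x ∈ K` iff `σ x = x`. [folklore] -/
theorem mem_K6_iff (x : L21) : x ∈ K6 ↔ σ x = x := by
  rw [K6, IntermediateField.mem_fixedField_iff]
  constructor
  · intro h
    exact h σ (Subgroup.mem_zpowers σ)
  · intro h g hg
    have hle : H ≤ MulAction.stabilizer (L21 ≃ₐ[ℚ] L21) x := by
      rw [H, Subgroup.zpowers_le, MulAction.mem_stabilizer_iff]
      exact h
    exact hle hg

/-- Every complex embedding of `K` extends to one of `ℚ(ζ₂₁)` (`ℂ` is algebraically closed).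
[folklore] -/
theorem exists_extension (φ : K6 →+* ℂ) :
    ∃ Φ : L21 →+* ℂ, Φ.comp (algebraMap K6 L21) = φ := by
  letI : Algebra K6 ℂ := φ.toAlgebra
  let Φ : L21 →ₐ[K6] ℂ := IsAlgClosed.lift
  exact ⟨Φ.toRingHom, Φ.comp_algebraMap⟩

/-- **Two complex embeddings of `ℚ(ζ₂₁)` that agree on `K` differ by an element of `H`**: if
`Φ ζ = μ^a` then `Φ' ζ = μ^(a·13^j)` for some `j < 2`. (Galois theory: `ℚ(ζ₂₁)/K` is Galois with group
`H`.) [folklore] -/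
theorem exists_exponent_of_comp_eq {Φ Φ' : L21 →+* ℂ}
    (h : Φ.comp (algebraMap K6 L21) = Φ'.comp (algebraMap K6 L21)) {a : ℕ} (ha : Φ ζ = μ ^ a) :
    ∃ j : ℕ, j < 2 ∧ Φ' ζ = μ ^ (a * 13 ^ j) := by
  obtain ⟨g, hg⟩ := NumberField.ComplexEmbedding.exists_comp_symm_eq_of_comp_eq Φ Φ' h
  have hmem : g.symm.restrictScalars ℚ ∈ H := by
    rw [← fixingSubgroup_K6, IntermediateField.mem_fixingSubgroup_iff]
    intro x hx
    exact g.symm.commutes ⟨x, hx⟩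
  obtain ⟨j, hj, hjζ⟩ := exists_apply_ζ_of_mem_H hmem
  refine ⟨j, hj, ?_⟩
  rw [← hg, RingHom.comp_apply, pow_mul, ← ha, ← map_pow]
  exact congrArg Φ hjζ

/-- Residue arithmetic: `-1 ∉ H`, i.e. `20·a ≢ a·13^j (mod 21)` for units `a` and `j < 2`. Decided by
the kernel. [folklore] -/
theorem core_negOne_notMem_H : ∀ a : ℕ, a < 21 → a.Coprime 21 → ∀ j : ℕ, j < 2 →
    (20 * a) % 21 ≠ (a * 13 ^ j) % 21 := by
  decide

/-- **`K` is totally complex**: complex conjugation on `ℚ(ζ₂₁)` (`ζ ↦ ζ⁻¹ = ζ²⁰`) does not lie in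
`H = {ζ ↦ ζ, ζ¹³}`, so no complex embedding of `K` is real. [folklore] -/
instance instIsTotallyComplexK6 : IsTotallyComplex K6 := by
  refine ⟨fun v ↦ ?_⟩
  rw [← NumberField.InfinitePlace.not_isReal_iff_isComplex, NumberField.InfinitePlace.isReal_iff,
    NumberField.ComplexEmbedding.isReal_iff]
  intro hreal
  obtain ⟨Φ, hΦ⟩ := exists_extension v.embedding
  obtain ⟨a, ha, hac, hΦa⟩ := exists_apply_ζ_eq Φ
  have hconj : Φ.comp (algebraMap K6 L21) =
      (NumberField.ComplexEmbedding.conjugate Φ).comp (algebraMap K6 L21) := by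
    ext x
    have hx := RingHom.congr_fun hΦ x
    rw [RingHom.comp_apply] at hx
    rw [RingHom.comp_apply, RingHom.comp_apply, NumberField.ComplexEmbedding.conjugate_coe_eq, hx,
      ← NumberField.ComplexEmbedding.conjugate_coe_eq, hreal]
  obtain ⟨j, hj, hjζ⟩ := exists_exponent_of_comp_eq hconj hΦa
  have h20 : NumberField.ComplexEmbedding.conjugate Φ ζ = μ ^ (20 * a) := by
    rw [NumberField.ComplexEmbedding.conjugate_coe_eq, hΦa, map_pow, conj_μ, ← pow_mul]
  have heq : μ ^ ((20 * a) % 21) = μ ^ ((a * 13 ^ j) % 21) := by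
    rw [← μ_pow_mod, ← μ_pow_mod, ← h20, hjζ]
  exact core_negOne_notMem_H a ha hac j hj
    (μ_pow_inj (Nat.mod_lt _ (by norm_num)) (Nat.mod_lt _ (by norm_num)) heq)

/-- `K/ℚ` is abelian (a subextension of the cyclotomic, hence abelian, extension `ℚ(ζ₂₁)/ℚ`;
Mathlib's `IsAbelianGalois.of_algHom` along the inclusion `K ⊂ ℚ(ζ₂₁)`), stated for the canonical
`ℚ`-algebra structure `DivisionRing.toRatAlgebra` that `NumberField.IsCMField.of_isAbelianGalois` consumes.
[folklore] -/
instance instIsAbelianGaloisK6 : @IsAbelianGalois ℚ K6 _ _ DivisionRing.toRatAlgebra :=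
  haveI : IsAbelianGalois ℚ L21 := IsCyclotomicExtension.isAbelianGalois {21} ℚ L21
  IsAbelianGalois.of_algHom (K := ℚ) (L := K6) (M := L21) (algebraMap K6 L21).toRatAlgHom

/-- `K/ℚ` is integral (a number field), for the canonical `ℚ`-algebra structure. [folklore] -/
instance instIsIntegralK6 : @Algebra.IsIntegral ℚ K6 _ _ DivisionRing.toRatAlgebra :=
  inferInstance

/-- **`K` is a CM field** (a totally complex abelian number field; Mathlib's
`NumberField.IsCMField.of_isAbelianGalois`). [folklore] -/
instance instIsCMFieldK6 : IsCMField K6 := IsCMField.of_isAbelianGalois K6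

/-! ### The cube root of unity `ω = ζ⁷ ∈ K` -/

/-- `ζ⁷ ∈ K`: `σ(ζ⁷) = ζ⁹¹ = ζ⁷` (`91 ≡ 7 mod 21`). [folklore] -/
theorem ζ_pow_seven_mem_K6 : ζ ^ 7 ∈ K6 := by
  rw [mem_K6_iff, map_pow, σ_ζ, ← pow_mul, ζ_pow_mod (13 * 7)]

/-- `ω := ζ⁷`, as an element of `K` (decl `zeta3K`). [folklore] -/
def zeta3K : K6 := ⟨ζ ^ 7, ζ_pow_seven_mem_K6⟩

/-- `ω ∈ K` is a primitive cube root of unity (`ζ` has order `21 = 7 · 3`; primitivity is inherited along the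
injection `K ⊂ ℚ(ζ₂₁)`), so `K ⊃ ℚ(ω) = ℚ(√-3)` and `(2ω + 1)² = -3` in `𝓞_K`. [folklore] -/
theorem isPrimitiveRoot_zeta3K : IsPrimitiveRoot zeta3K 3 := by
  have h : IsPrimitiveRoot (algebraMap K6 L21 zeta3K) 3 :=
    isPrimitiveRoot_ζ.pow (by norm_num) (show (21 : ℕ) = 7 * 3 by norm_num)
  exact h.of_map_of_injective (algebraMap K6 L21).injective

/-! ### No primitive 9th root of unity in `ℚ(ζ₂₁)` -/

/-- `φ(63) = φ(9) φ(7) = 36`. [folklore] -/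
theorem totient_63 : Nat.totient 63 = 36 := by
  rw [show (63 : ℕ) = 3 ^ 2 * 7 by norm_num, Nat.totient_mul (by norm_num : Nat.Coprime (3 ^ 2) 7),
    Nat.totient_prime_pow Nat.prime_three (by norm_num), Nat.totient_prime (by norm_num : Nat.Prime 7)]
  norm_num

/-- **`ℚ(ζ₂₁)` contains no primitive 9th root of unity.** If `u ∈ ℚ(ζ₂₁)` had order `9`, then `u · ζ³`
(`ζ³` of order `7`, coprime to `9`) would be a primitive `63`rd root of unity, whose minimal polynomial over `ℚ`
is `Φ₆₃` of degree `φ(63) = 36` (`Polynomial.cyclotomic_eq_minpoly_rat`) — more than `[ℚ(ζ₂₁) : ℚ] = 12`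
(`minpoly.natDegree_le`). (Equivalently: the roots of unity of `ℚ(ζ₂₁)` are the `42`nd ones.) [folklore] -/
theorem not_isPrimitiveRoot_nine (u : L21) (hu : IsPrimitiveRoot u 9) : False := by
  have hv : IsPrimitiveRoot (ζ ^ 3) 7 := isPrimitiveRoot_ζ.pow (by norm_num) (show (21 : ℕ) = 3 * 7 by norm_num)
  have hcop : (orderOf u).Coprime (orderOf (ζ ^ 3)) := by
    rw [← hu.eq_orderOf, ← hv.eq_orderOf]
    decide
  have h63 : IsPrimitiveRoot (u * ζ ^ 3) 63 := by
    rw [IsPrimitiveRoot.iff_orderOf, (Commute.all u (ζ ^ 3)).orderOf_mul_eq_mul_orderOf_of_coprime hcop,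
      ← hu.eq_orderOf, ← hv.eq_orderOf]
  have hdeg : (minpoly ℚ (u * ζ ^ 3)).natDegree ≤ Module.finrank ℚ L21 := minpoly.natDegree_le _
  rw [← cyclotomic_eq_minpoly_rat h63 (by norm_num), natDegree_cyclotomic, totient_63, finrank_L21] at hdeg
  omega

/-- **There is no ring homomorphism `ℚ(ζ₉) → ℚ(ζ₂₁)`** (it would carry `ζ₉` to a primitive 9th root of
unity of `ℚ(ζ₂₁)`). This is the arithmetic that makes the two CM threefolds of the `HodgeUnitaryThreefoldPair`
witness non-isogenous: their endomorphism algebras are `ℚ(ζ₉)` and `K ⊂ ℚ(ζ₂₁)`. [folklore] -/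
theorem not_nonempty_ringHom_cyclotomicNine {F : Type*} [Field F] [NumberField F]
    [IsCyclotomicExtension {9} ℚ F] : ¬ Nonempty (F →+* L21) := by
  rintro ⟨f⟩
  exact not_isPrimitiveRoot_nine _
    ((IsCyclotomicExtension.zeta_spec 9 ℚ F).map_of_injective (f := f) f.injective)

end Cyclotomic21

end Summit.HodgeConjecture.HodgeConjecture.Ring2.Atlas

end
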